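import Literature.NumberTheory.Automorphic.Liu2021.AppendixC.AlbaneseCocycle
import Mathlib.AlgebraicGeometry.Gluing
import Mathlib.AlgebraicGeometry.PullbackCarrier
import HarnessLib

/-!
# Liu 2021 App. C / Lang VIII §6: the trace morphism `α_X ≫ Σ_g Alb_{g}` of `∇X` EXTENDS to a `(Δ × Δ)`-invariant
# morphism on all of `X × X` (the extension step of the Albanese trace of a finite quotient)

[Liu2021] = Yifeng Liu, *Fourier–Jacobi cycles and arithmetic relative trace formula*, Camb. J. Math. **9** (2021)
= arXiv:2102.11518 (`l. NNNN` = lines of `FJcycle.tex`, as in `AppendixC/Glue.lean`); [Lang1983AbelianVarieties] = S. Lang,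
*Abelian Varieties*, Ch. VIII §6 Thm. 13 (proof, pp. 224–227: the trace `h_*` of a finite Galois quotient).  PROOF FILE
(theorems only; no definition, no named fact, no instance, no `sorry`) — piece F3 of the discharge of the named fact
`AlbaneseTraceOfFiniteQuotient` (`AppendixC/AlbaneseFiniteQuotientTrace.lean`; cell `hodgecm-mathlib`, D-0151, row VI-5, plan of
record B-p16 2026-08-28: «extend `F := α_X ≫ Σ_g Alb_g` to a `(Δ × Δ)`-invariant `F̃ : X × X → Alb_X` by gluing `F ∘ (s × t)⁻¹` on
the clopen translates `(s × t)·∇X` and `1` on the clopen complement»).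

Setting: `X` a `k`-scheme, `aX : Albanese X` (Def. 2.3: `∇X`, `Alb_X`, `α_X`) whose `∇X` is TRANSITIVE (`Nabla.IsTransitive`) and whose
`α_X` is a COCYCLE (`Albanese.IsCocycle`), and `act : Δ →* Aut X` an action of a FINITE group.  `F := α_X ≫ Σ_{g ∈ Δ} Alb_{act g} :
∇X ⟶ Alb_X` is the `∇`-morphism of `AppendixC/AlbaneseTraceOfNablaDescent.lean`.

* §1 `Albanese.IsCocycle.comp_traceMap_eq_of_translates` — THE POINT COMPUTATION: if two `T`-points `p₁, p₂` of `∇X` have the same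
  image in `X × X` after the translations `act s × act t`, `act s′ × act t′`, then `F(p₁) = F(p₂)` (reduce by the diagonal
  invariance `∇(act σ) ≫ F = F`, `nablaMap_comp_α_comp_sum_map`, to two points `(a,b)`, `(a, u·b)` of `∇X` and use the
  well-definedness step `IsCocycle.comp_α_comp_sum_map_eq` — stabiliser sums vanish).
* §2 the clopen translates `W_{s,t} := (act s × act t)(∇X) ↪ X × X` (open immersions `translate s t := ∇X ↪ X × X ≫ (act s × act t)`),
  their complement, and the open cover of `X × X` they form (`Scheme.Cover.mkOfCovers`);
* §3 **`Albanese.exists_invariant_extension`** — there is `F̃ : X × X ⟶ Alb_X` (over `k`) with `(∇X ↪ X × X) ≫ F̃ = F` and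
  `((act s) × (act t)) ≫ F̃ = F̃` for all `s t : Δ` (glue `F` on every translate and the unit section on the complement:
  `Scheme.Cover.glueMorphisms`, compatibility on overlaps by §1 in Yoneda form — no reducedness needed —, and uniqueness on the
  cover `Scheme.Cover.hom_ext` for the invariance).

HC_CM is NOT proved here; nothing in this file discharges a COR-CM binder; the named fact (T) is NOT asserted.

## References
* [Lang1983AbelianVarieties] S. Lang, *Abelian Varieties* (1983 reprint), Ch. VIII §6 Thm. 13, proof pp. 224–227.
* [Liu2021] Y. Liu, arXiv:2102.11518 = Camb. J. Math. 9 (2021), §2.1 Def. 2.1 (1) (l. 1171–1176), Def. 2.3 (l. 1202–1208), Lem. 2.4 (1).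
-/

noncomputable section

open CategoryTheory CategoryTheory.Limits AlgebraicGeometry MonoidalCategory CartesianMonoidalCategory
open Literature.AlgebraicGeometry.Motives (SchemeOver AbelianVariety)

namespace Literature.NumberTheory.Automorphic.Liu2021.AppendixC

universe u

open scoped MonObj

variable {k : Type u} [Field k] {X : SchemeOver k}

namespace Albanese

section Translates

variable {aX : Albanese X} {Δ : Type*} [Group Δ] [Fintype Δ] (act : Δ →* Aut X)

omit [Fintype Δ] in
/-- `(act (g * h)).hom = (act h).hom ≫ (act g).hom` (Mathlib's `Aut X` multiplies by `g * h = h ≪≫ g`). [folklore] -/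
private theorem act_mul_hom' (g h : Δ) : (act (g * h)).hom = (act h).hom ≫ (act g).hom := by
  rw [map_mul]; rfl

omit [Fintype Δ] in
/-- `(act g).hom ≫ (act g⁻¹).hom = 𝟙`. [folklore] -/
private theorem act_hom_comp_act_inv_hom (g : Δ) : (act g).hom ≫ (act g⁻¹).hom = 𝟙 X := by
  rw [← act_mul_hom', inv_mul_cancel, map_one]; rfl

omit [Fintype Δ] in
/-- `(act g⁻¹).hom ≫ (act g).hom = 𝟙`. [folklore] -/
private theorem act_inv_hom_comp_act_hom (g : Δ) : (act g⁻¹).hom ≫ (act g).hom = 𝟙 X := by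
  rw [← act_mul_hom', mul_inv_cancel, map_one]; rfl

/-! ## §1. The point computation: `F` agrees on points with the same translated image -/

/-- **`F := α_X ≫ Σ_g Alb_{act g}` takes the same value at two `T`-points of `∇X` whose images in `X × X` agree after the
translations `act s × act t` and `act s′ × act t′`.**  PROOF: writing `p₁ = (a, b)`, `p₂ = (a′, b′)`, the hypothesis gives
`a′ = σ·a`, `b′ = σ·(u·b)` with `σ := s′⁻¹s`, `u := σ⁻¹t′⁻¹t`; so `p₂ = ∇(act σ)(q)` for the point `q := ∇(act σ⁻¹)(p₂) = (a, u·b)` of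
`∇X`; `F(p₂) = F(q)` by the diagonal invariance of `F` (`nablaMap_comp_α_comp_sum_map`) and `F(q) = F(p₁)` by the well-definedness
step `IsCocycle.comp_α_comp_sum_map_eq` (stabiliser sums vanish; transitivity + cocycle).  This is the compatibility on the
overlaps of the translates `(s × t)·∇X` in Lang's construction of `h_*`.  Ours.
[cite: Lang1983AbelianVarieties, Ch. VIII §6, proof of Thm. 13 (pp. 224–227)] [cite: Liu2021, §2.1 Def. 2.1 (1), Def. 2.3 (l. 1171–1208)] -/
theorem IsCocycle.comp_traceMap_eq_of_translates (hN : aX.nabla.IsTransitive) (h : aX.IsCocycle)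
    (s t s' t' : Δ) {T : SchemeOver k} (p₁ p₂ : T ⟶ aX.nabla.N)
    (hp : p₁ ≫ aX.nabla.incl ≫ ((act s).hom ⊗ₘ (act t).hom) = p₂ ≫ aX.nabla.incl ≫ ((act s').hom ⊗ₘ (act t').hom)) :
    p₁ ≫ (aX.α ≫ (∑ g, aX.map aX (act g).hom).hom.hom.hom) =
      p₂ ≫ (aX.α ≫ (∑ g, aX.map aX (act g).hom).hom.hom.hom) := by
  -- coordinates of the two points
  set a : T ⟶ X := p₁ ≫ aX.nabla.incl ≫ fst X X with ha
  set b : T ⟶ X := p₁ ≫ aX.nabla.incl ≫ snd X X with hb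
  set a' : T ⟶ X := p₂ ≫ aX.nabla.incl ≫ fst X X with ha'
  set b' : T ⟶ X := p₂ ≫ aX.nabla.incl ≫ snd X X with hb'
  have hp₁ : p₁ ≫ aX.nabla.incl = lift a b := by
    apply CartesianMonoidalCategory.hom_ext <;> simp [ha, hb]
  have hp₂ : p₂ ≫ aX.nabla.incl = lift a' b' := by
    apply CartesianMonoidalCategory.hom_ext <;> simp [ha', hb']
  -- the hypothesis in coordinates: `a ≫ act s = a' ≫ act s'`, `b ≫ act t = b' ≫ act t'`
  have hlift : lift (a ≫ (act s).hom) (b ≫ (act t).hom) = lift (a' ≫ (act s').hom) (b' ≫ (act t').hom) := by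
    rw [← lift_map, ← hp₁, ← lift_map, ← hp₂, Category.assoc, Category.assoc]
    exact hp
  have hfa : a ≫ (act s).hom = a' ≫ (act s').hom := by simpa using congrArg (· ≫ fst X X) hlift
  have hfb : b ≫ (act t).hom = b' ≫ (act t').hom := by simpa using congrArg (· ≫ snd X X) hlift
  -- `σ := s'⁻¹ s`, `u := σ⁻¹ t'⁻¹ t`
  set σ : Δ := s'⁻¹ * s with hσ
  set u : Δ := σ⁻¹ * (t'⁻¹ * t) with hu
  have ha'σ : a' = a ≫ (act σ).hom := by
    rw [hσ, act_mul_hom', ← Category.assoc, hfa, Category.assoc, act_hom_comp_act_inv_hom, Category.comp_id]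
  have hb'σ : b' = (b ≫ (act u).hom) ≫ (act σ).hom := by
    rw [Category.assoc, ← act_mul_hom', hu, mul_inv_cancel_left, act_mul_hom', ← Category.assoc, hfb, Category.assoc,
      act_hom_comp_act_inv_hom, Category.comp_id]
  -- `q := ∇(act σ⁻¹)(p₂)` is a point of `∇X` over `(a, u·b)`
  set q : T ⟶ aX.nabla.N := p₂ ≫ aX.nabla.map aX.nabla (act σ⁻¹).hom with hq
  have hq_incl : q ≫ aX.nabla.incl = lift a (b ≫ (act u).hom) := by
    rw [hq, Category.assoc, Nabla.map_incl, ← Category.assoc, hp₂, lift_map, ha'σ, hb'σ]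
    simp only [Category.assoc, act_hom_comp_act_inv_hom act, Category.comp_id]
  -- `p₂ = ∇(act σ)(q)`
  have hp₂q : p₂ = q ≫ aX.nabla.map aX.nabla (act σ).hom := by
    rw [hq, Category.assoc, ← Nabla.map_comp, act_inv_hom_comp_act_hom, Nabla.map_id, Category.comp_id]
  rw [hp₂q, Category.assoc, nablaMap_comp_α_comp_sum_map aX act σ]
  exact (h.comp_α_comp_sum_map_eq act hN u a b p₁ q hp₁ hq_incl).symm

/-! ## §2–§3. Gluing `F` on the translates `(s × t)·∇X` and `1` on their complement -/

/-- **The trace morphism `F := α_X ≫ Σ_g Alb_{act g}` of `∇X` extends to a `(Δ × Δ)`-invariant morphism `F̃ : X × X ⟶ Alb_X`**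
(over `k`): `(∇X ↪ X × X) ≫ F̃ = F` and `((act s) × (act t)) ≫ F̃ = F̃` for all `s, t ∈ Δ` — for an Albanese datum with transitive `∇X`
and cocycle `α_X` and a finite group `Δ` acting on `X`.  CONSTRUCTION: the translates `W_{s,t} := (act s × act t)(∇X)` are open and
closed in `X × X` (images of `∇X ↪ X × X` under automorphisms), so together with the complement of their (finite, closed) union they form
an open cover of `X × X`; glue `F` (read on `W_{s,t}` through the translation) and the unit section (on the complement) with Mathlib's
`Scheme.Cover.glueMorphisms` — the compatibility on `W_{s,t} ∩ W_{s′,t′}` is `IsCocycle.comp_traceMap_eq_of_translates` applied to the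
two projections of the overlap (Yoneda; no reducedness needed), the other overlaps are empty or trivial —; the two identities are checked
chart by chart (`Scheme.Cover.hom_ext`).  This is the extension step of Lang's trace `h_*` in the base-point-free language of `∇`.
Ours. [cite: Lang1983AbelianVarieties, Ch. VIII §6, proof of Thm. 13 (pp. 224–227)] [cite: Liu2021, §2.1 Def. 2.1 (1), Def. 2.3 (l. 1171–1208), Lem. 2.4 (1)] -/
theorem exists_invariant_extension (hN : aX.nabla.IsTransitive) (h : aX.IsCocycle) :
    ∃ Ft : X ⊗ X ⟶ aX.Alb.X,
      aX.nabla.incl ≫ Ft = aX.α ≫ (∑ g, aX.map aX (act g).hom).hom.hom.hom ∧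
        ∀ s t : Δ, ((act s).hom ⊗ₘ (act t).hom) ≫ Ft = Ft := by
  classical
  set F : aX.nabla.N ⟶ aX.Alb.X := aX.α ≫ (∑ g, aX.map aX (act g).hom).hom.hom.hom with hF
  haveI hio : IsOpenImmersion aX.nabla.incl.left := aX.nabla.isOpenImmersion_incl
  haveI hic : IsClosedImmersion aX.nabla.incl.left := aX.nabla.isClosedImmersion_incl
  -- the translations `G s t := act s × act t`, automorphisms of `X × X` over `k`
  let G : Δ → Δ → (X ⊗ X ⟶ X ⊗ X) := fun s t => (act s).hom ⊗ₘ (act t).hom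
  have hGmul : ∀ s t s' t', G s' t' ≫ G s t = G (s * s') (t * t') := fun s t s' t' => by
    simp only [G, tensorHom_comp_tensorHom, act_mul_hom']
  have hGone : G 1 1 = 𝟙 (X ⊗ X) := by
    simp only [G, map_one]
    exact id_tensorHom_id X X
  have hGinv : ∀ s t, G s t ≫ G s⁻¹ t⁻¹ = 𝟙 (X ⊗ X) := fun s t => by
    rw [hGmul, inv_mul_cancel, inv_mul_cancel, hGone]
  have hGinv' : ∀ s t, G s⁻¹ t⁻¹ ≫ G s t = 𝟙 (X ⊗ X) := fun s t => by
    rw [hGmul, mul_inv_cancel, mul_inv_cancel, hGone]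
  haveI hGiso : ∀ s t, IsIso (G s t).left := fun s t =>
    ⟨⟨(G s⁻¹ t⁻¹).left, by rw [← Over.comp_left, hGinv]; rfl, by rw [← Over.comp_left, hGinv']; rfl⟩⟩
  -- the translates `j s t := ∇X ↪ X × X ≫ G s t`, open and closed immersions
  let j : Δ × Δ → (aX.nabla.N ⟶ X ⊗ X) := fun st => aX.nabla.incl ≫ G st.1 st.2
  have hjleft : ∀ st, (j st).left = aX.nabla.incl.left ≫ (G st.1 st.2).left := fun st => rfl
  haveI hjo : ∀ st, IsOpenImmersion (j st).left := fun st => by rw [hjleft]; infer_instance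
  haveI hjc : ∀ st, IsClosedImmersion (j st).left := fun st => by rw [hjleft]; infer_instance
  have hjG : ∀ s t st, j st ≫ G s t = j (s * st.1, t * st.2) := fun s t st => by
    change (aX.nabla.incl ≫ G st.1 st.2) ≫ G s t = aX.nabla.incl ≫ G _ _
    rw [Category.assoc, hGmul]
  have hj_one : j (1, 1) = aX.nabla.incl := by
    change aX.nabla.incl ≫ G 1 1 = _
    rw [hGone, Category.comp_id]
  -- the complement of the translates
  set Cset : Set ↥(X ⊗ X).left := (⋃ st : Δ × Δ, Set.range ⇑(j st).left)ᶜ with hCset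
  have hCopen : IsOpen Cset := by
    rw [hCset, isOpen_compl_iff]
    exact isClosed_iUnion_of_finite fun st => (j st).left.isClosedEmbedding.isClosed_range
  let U : (X ⊗ X).left.Opens := ⟨Cset, hCopen⟩
  have hUrange : Set.range ⇑U.ι = Cset := U.range_ι
  have hdisj : ∀ st (y : ↥aX.nabla.N.left) (c : ↥(U : Scheme)), (j st).left y ≠ U.ι c := by
    intro st y c hyc
    have hc : U.ι c ∈ Cset := hUrange ▸ Set.mem_range_self c
    rw [← hyc, hCset, Set.mem_compl_iff, Set.mem_iUnion] at hc
    exact hc ⟨st, y, rfl⟩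
  -- `G s t` maps the complement into itself
  have hGC : ∀ s t, Set.range ⇑(U.ι ≫ (G s t).left) ⊆ Set.range ⇑U.ι := by
    rintro s t _ ⟨c, rfl⟩
    rw [hUrange, hCset, Set.mem_compl_iff, Set.mem_iUnion]
    rintro ⟨st, y, hy⟩
    have hc : U.ι c ∈ Cset := hUrange ▸ Set.mem_range_self c
    rw [hCset, Set.mem_compl_iff, Set.mem_iUnion] at hc
    refine hc ⟨(s⁻¹ * st.1, t⁻¹ * st.2), y, ?_⟩
    have e1 : (j st ≫ G s⁻¹ t⁻¹).left y = (G s⁻¹ t⁻¹).left ((G s t).left (U.ι c)) := by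
      rw [Over.comp_left, Scheme.Hom.comp_apply, hy, Scheme.Hom.comp_apply]
    rw [hjG] at e1
    rw [e1, ← Scheme.Hom.comp_apply, ← Scheme.Hom.comp_apply, ← Over.comp_left, hGinv, Over.id_left,
      Category.comp_id]
  -- the open cover of `X × X`
  let obj : Option (Δ × Δ) → Scheme.{u} := fun i => Option.rec (↑U) (fun _ => aX.nabla.N.left) i
  let map : ∀ i, obj i ⟶ (X ⊗ X).left := fun i =>
    match i with
    | none => U.ι
    | some st => (j st).left
  have hcovers : ∀ x, ∃ i y, (map i).base y = x := by
    intro x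
    by_cases hx : x ∈ ⋃ st : Δ × Δ, Set.range ⇑(j st).left
    · obtain ⟨st, y, rfl⟩ := Set.mem_iUnion.1 hx
      exact ⟨some st, y, rfl⟩
    · have hx' : x ∈ Set.range ⇑U.ι := by rw [hUrange, hCset]; exact hx
      obtain ⟨c, rfl⟩ := hx'
      exact ⟨none, c, rfl⟩
  let 𝒰 : (X ⊗ X).left.OpenCover := Scheme.Cover.mkOfCovers (Option (Δ × Δ)) obj map hcovers (fun i => by
    cases i with
    | none => exact (inferInstance : IsOpenImmersion U.ι)
    | some st => exact hjo st)
  -- the scheme over `k` on the complement, and the local morphisms to be glued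
  let Cov : SchemeOver k := Over.mk (U.ι ≫ (X ⊗ X).hom)
  let oneC : Cov ⟶ aX.Alb.X := 1
  let f : ∀ i, obj i ⟶ aX.Alb.X.left := fun i =>
    match i with
    | none => oneC.left
    | some _ => F.left
  -- compatibility on the overlaps
  have hf : ∀ i i', pullback.fst (𝒰.f i) (𝒰.f i') ≫ f i = pullback.snd (𝒰.f i) (𝒰.f i') ≫ f i' := by
    intro i i'
    cases i with
    | none =>
      cases i' with
      | none =>
        -- complement / complement: both sides are the unit point
        change pullback.fst U.ι U.ι ≫ oneC.left = pullback.snd U.ι U.ι ≫ oneC.left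
        let Pk : SchemeOver k := Over.mk (pullback.fst U.ι U.ι ≫ Cov.hom)
        let q₁ : Pk ⟶ Cov := Over.homMk (pullback.fst U.ι U.ι) rfl
        let q₂ : Pk ⟶ Cov := Over.homMk (pullback.snd U.ι U.ι) (by
          change pullback.snd U.ι U.ι ≫ U.ι ≫ (X ⊗ X).hom = pullback.fst U.ι U.ι ≫ U.ι ≫ (X ⊗ X).hom
          rw [← Category.assoc, ← pullback.condition, Category.assoc])
        have e₁ : pullback.fst U.ι U.ι ≫ oneC.left = (q₁ ≫ oneC).left := rfl
        have e₂ : pullback.snd U.ι U.ι ≫ oneC.left = (q₂ ≫ oneC).left := rfl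
        rw [e₁, e₂, MonObj.comp_one, MonObj.comp_one]
      | some st' =>
        -- complement / translate: empty overlap
        change pullback.fst U.ι (j st').left ≫ oneC.left = pullback.snd U.ι (j st').left ≫ F.left
        haveI : IsEmpty ↥(pullback U.ι (j st').left) := ⟨fun z =>
          hdisj st' (pullback.snd U.ι (j st').left z) (pullback.fst U.ι (j st').left z) (by
            rw [← Scheme.Hom.comp_apply, ← Scheme.Hom.comp_apply, pullback.condition])⟩
        exact Limits.IsInitial.hom_ext isInitialOfIsEmpty _ _
    | some st =>
      cases i' with
      | none =>
        -- translate / complement: empty overlap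
        change pullback.fst (j st).left U.ι ≫ F.left = pullback.snd (j st).left U.ι ≫ oneC.left
        haveI : IsEmpty ↥(pullback (j st).left U.ι) := ⟨fun z =>
          hdisj st (pullback.fst (j st).left U.ι z) (pullback.snd (j st).left U.ι z) (by
            rw [← Scheme.Hom.comp_apply, ← Scheme.Hom.comp_apply, pullback.condition])⟩
        exact Limits.IsInitial.hom_ext isInitialOfIsEmpty _ _
      | some st' =>
        -- translate / translate: the point computation of §1 on the two projections of the overlap
        change pullback.fst (j st).left (j st').left ≫ F.left = pullback.snd (j st).left (j st').left ≫ F.left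
        let Pk : SchemeOver k := Over.mk (pullback.fst (j st).left (j st').left ≫ aX.nabla.N.hom)
        let p₁ : Pk ⟶ aX.nabla.N := Over.homMk (pullback.fst (j st).left (j st').left) rfl
        let p₂ : Pk ⟶ aX.nabla.N := Over.homMk (pullback.snd (j st).left (j st').left) (by
          change pullback.snd _ _ ≫ aX.nabla.N.hom = pullback.fst _ _ ≫ aX.nabla.N.hom
          have e : (pullback.snd (j st).left (j st').left ≫ (j st').left) ≫ (X ⊗ X).hom =
              (pullback.fst (j st).left (j st').left ≫ (j st).left) ≫ (X ⊗ X).hom := by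
            rw [pullback.condition]
          simpa only [Category.assoc, Over.w] using e)
        have hp : p₁ ≫ aX.nabla.incl ≫ G st.1 st.2 = p₂ ≫ aX.nabla.incl ≫ G st'.1 st'.2 :=
          Over.OverMorphism.ext (pullback.condition)
        have key := h.comp_traceMap_eq_of_translates act hN st.1 st.2 st'.1 st'.2 p₁ p₂ hp
        exact congrArg CommaMorphism.left key
  -- glue
  let Ft₀ : (X ⊗ X).left ⟶ aX.Alb.X.left := 𝒰.glueMorphisms f hf
  have hFt₀ : ∀ i, map i ≫ Ft₀ = f i := fun i => 𝒰.ι_glueMorphisms f hf i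
  have hw : Ft₀ ≫ aX.Alb.X.hom = (X ⊗ X).hom := by
    refine 𝒰.hom_ext _ _ fun i => ?_
    change map i ≫ Ft₀ ≫ aX.Alb.X.hom = map i ≫ (X ⊗ X).hom
    rw [← Category.assoc, hFt₀]
    cases i with
    | none => exact Over.w oneC
    | some st => change F.left ≫ _ = (j st).left ≫ _; rw [Over.w F, Over.w (j st)]
  let Ft : X ⊗ X ⟶ aX.Alb.X := Over.homMk Ft₀ hw
  refine ⟨Ft, ?_, fun s t => ?_⟩
  · -- restriction to `∇X`: the chart `(1,1)` is `∇X ↪ X × X` itself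
    apply Over.OverMorphism.ext
    change aX.nabla.incl.left ≫ Ft₀ = F.left
    rw [← hj_one]
    exact hFt₀ (some (1, 1))
  · -- invariance under `G s t`, chart by chart
    apply Over.OverMorphism.ext
    change (G s t).left ≫ Ft₀ = Ft₀
    refine 𝒰.hom_ext _ _ fun i => ?_
    cases i with
    | some st' =>
      change (j st').left ≫ (G s t).left ≫ Ft₀ = (j st').left ≫ Ft₀
      rw [← Category.assoc, ← Over.comp_left, hjG]
      exact (hFt₀ (some (s * st'.1, t * st'.2))).trans (hFt₀ (some st')).symm
    | none =>
      change U.ι ≫ (G s t).left ≫ Ft₀ = U.ι ≫ Ft₀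
      -- `G s t` maps the complement into itself
      let φ : (U : Scheme) ⟶ U := IsOpenImmersion.lift U.ι (U.ι ≫ (G s t).left) (hGC s t)
      have hφ : φ ≫ U.ι = U.ι ≫ (G s t).left := IsOpenImmersion.lift_fac _ _ _
      let φk : Cov ⟶ Cov := Over.homMk φ (by
        change φ ≫ U.ι ≫ (X ⊗ X).hom = U.ι ≫ (X ⊗ X).hom
        rw [← Category.assoc, hφ, Category.assoc, Over.w (G s t)])
      rw [← Category.assoc, ← hφ, Category.assoc]
      have e := hFt₀ none
      refine ((congrArg (fun m => φ ≫ m) e).trans ?_).trans e.symm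
      change (φk ≫ oneC).left = oneC.left
      rw [MonObj.comp_one]

end Translates

end Albanese

end Literature.NumberTheory.Automorphic.Liu2021.AppendixC

end
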